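import Summits.CriticalPhenomena.PercolationContinuityZ3.Theorems.Transplant.KNCells2ThetaPosKit
import HarnessLib

/-!
# F8 (generic, lag-1 anchors), design (D): the node theorem with the probabilistic obligations restricted to CHOSEN edges
# (`lawful₂_chosen`, `theta_pos_of_cells₂_chosen`, `theta_pos_of_kit₂_chosen(')`, and the replay invariant of the anchors; the bundled
# predicate `KitAtChosen` is in the companion file `KNCells2KitAtChosen`)

builds on p205010 (kernel theorem, internal audit signed; external expert review pending) — nothing in this file uses p205010.
Lane `prim-bschramm`, seat `prim-bschramm-p5` (gen 3, refuter; interface objection 14:41Z), helper file (`--supports stmt-CriticalPhenomena-4575`).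

`lawful₂` (KNCells2Reach, p2-g2) consumes the failure bound `hfail` ONLY at the edge the scheme actually chooses after a valid history
(`Lawful.fail` quantifies over `(mst h).choice = some e`, and the proof of `lawful₂` has that fact in hand).  The landed node theorems
`theta_pos_of_cells₂` / `theta_pos_of_kit₂(')` and stmt's `KSchA.KitAt` nevertheless ask for `hfail` / `hface` / `hreach` at EVERY pair
`(h, e)` with `Valid₂ h e`.  For the `ℤ^d` regression (anchor type `Unit`) the surplus is harmless; for the position-dependent concentric
schedule of the `X □ ℤ²` instance (`KNCellsBoxProdZ2ConcScheduleG`: radii at anchor `0` depend on the macro-position) it is not provable: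
a HYPOTHETICAL edge whose source was never a replay target carries the anchors `(a₀, a₀)` at an arbitrary position, where the schedule's
cube is fatter than its far box.  This file states the node theorems with the obligations restricted to chosen edges — one extra hypothesis
`(S.astOf₂ G h).st.choice = some e` per clause, proofs otherwise VERBATIM those of p2-g2 / the lead / stmt — and proves the replay invariant
that turns "chosen" into anchor bookkeeping: the source of a chosen edge is occupied, and an occupied macro-vertex is either the root with
both anchors `a₀` or a former target whose stub anchor is the re-centring rule applied to its region anchor (`anchors_of_choice`).  For the
concentric instance (`anchor a _ _ = a + 1`, `a₀ = 0`) this is exactly the dichotomy `(α, β) = (0, 0) ∧ e.1 = 0` or `β = α + 1`.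
[cite: KozmaNitzan2024, §4 Theorem 6 (pp. 25–31)]
-/

noncomputable section

open MeasureTheory ProbabilityTheory
open scoped ENNReal Classical

namespace Summit.CriticalPhenomena.PercolationContinuityZ3.Theorems

namespace Transplant

namespace KNCells

open Literature.Probability.Percolation Literature.Probability.LatticeModels SimpleGraph GadgetSystem ProbeHistory HSiteScheme Contour

namespace KSchA

section Replay

variable {V : Type*} [DecidableEq V] {A : Type*} {G : SimpleGraph V} [G.LocallyFinite] {S : KSchA V A}

/-- **Replay invariant of the anchors.**  After any history, every macro-vertex either carries both anchors `a₀` and is occupied only if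
it is the root, or its stub anchor is the re-centring rule applied to its region anchor (it was a target of a replayed probe). [folklore] -/
theorem anchors_replay (h : ProbeHistory V) (v : Site 2) :
    (∃ P : Finset (Sym2 V), (S.astOf₂ G h).dep v = S.Γ.anchor ((S.astOf₂ G h).arr v) v P) ∨
      ((S.astOf₂ G h).arr v = S.Γ.a₀ ∧ (S.astOf₂ G h).dep v = S.Γ.a₀ ∧ (v ∈ (S.astOf₂ G h).st.occ → v = 0)) := by
  induction h generalizing v with
  | nil =>
    right
    refine ⟨rfl, rfl, fun hv => ?_⟩
    simpa [astOf₂_nil, HState.start] using hv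
  | cons r h ih =>
    cases r with
    | none => simpa only [astOf₂_cons_none] using ih v
    | some r =>
      rw [astOf₂_cons_some]
      cases hc : (S.astOf₂ G h).st.choice with
      | none => exact ih v
      | some e =>
        dsimp only
        by_cases hv : v = tgt e
        · subst hv
          left
          refine ⟨S.seen G h e ((S.astOf₂ G h).arr e.1) r.2, ?_⟩
          simp only [Function.update_self, depB]
        · rcases ih v with ⟨P, hP⟩ | ⟨h1, h2, h3⟩
          · left
            exact ⟨P, by simp only [Function.update_of_ne hv]; exact hP⟩
          · right
            refine ⟨by simp only [Function.update_of_ne hv]; exact h1, by simp only [Function.update_of_ne hv]; exact h2, fun hocc => ?_⟩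
            have hocc' : v ∈ insert (tgt e) (S.astOf₂ G h).st.occ := HState.occ_update_subset _ _ _ hocc
            rcases Finset.mem_insert.1 hocc' with h' | h'
            · exact absurd h' hv
            · exact h3 h'

/-- **Anchors of a CHOSEN edge**: the source of the scheme's chosen edge is occupied, hence either it is the root and the probe runs with both
anchors `a₀`, or its stub anchor is the re-centring rule applied to its region anchor. [folklore] -/
theorem anchors_of_choice (h : ProbeHistory V) {e : Site 2 × MDir} (hc : (S.astOf₂ G h).st.choice = some e) :
    (∃ P : Finset (Sym2 V), S.aOf₂ G h e = S.Γ.anchor (S.aOf₁ G h e) e.1 P) ∨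
      (e.1 = 0 ∧ S.aOf₁ G h e = S.Γ.a₀ ∧ S.aOf₂ G h e = S.Γ.a₀) := by
  rcases anchors_replay (S := S) (G := G) h e.1 with ⟨P, hP⟩ | ⟨h1, h2, h3⟩
  · exact Or.inl ⟨P, hP⟩
  · exact Or.inr ⟨h3 (HState.cand_of_choice hc).1, h1, h2⟩

end Replay

section Node

variable {V : Type} [DecidableEq V] [Countable V]
variable {A : Type*} {G : SimpleGraph V} [G.LocallyFinite] {S : KSchA V A} {FD : FaceData V A} {LD : LevelData V A}

/-- **`scheme₂` is lawful from the failure bound at CHOSEN edges only** (proof = p2-g2's `lawful₂`, which already had the choice in hand).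
[cite: KozmaNitzan2024, §4 pp. 25–31] -/
theorem lawful₂_chosen (hΓ : RunGeom G S.Γ) (hA : AnchGeom S.Γ) (hsep : SepGeom₂ G S.Γ) {ε : ℝ}
    (hQ0 : ∀ du : MDir, 1 - S.δc < (prodBernoulli (pinW (KNLevels.lattW G S.p) ↑(S.U₀ G) ↑(S.U₀ G))).real
      (⋃ t ∈ (↑(S.Γ.M S.Γ.a₀ ((0 : Site 2) + stepVec du)) : Set V),
        openConnIn (↑(S.Γ.Q S.Γ.a₀ 0 ∪ S.Γ.Ewv S.Γ.a₀ 0 du) : Set V) S.Γ.root t))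
    (hfail : ∀ h e, (S.astOf₂ G h).st.choice = some e → S.Valid₂ G h e →
      (bondPercolation G S.p).real
        {ω | ¬S.succ₂ G h e (S.aOf₁ G h e) (S.aOf₂ G h e) ((S.probe₂ G h e (S.aOf₁ G h e) (S.aOf₂ G h e)).read ω)} ≤ ε) :
    (S.scheme₂ G).Lawful G S.p ε where
  fresh := by
    intro h P hP
    obtain ⟨e, -, -, rfl⟩ := S.nextProbe₂_eq_some hP
    constructor
    · rw [Set.disjoint_left]
      intro x hx hxU
      exact (Finset.mem_sdiff.1 (Finset.mem_coe.1 hx)).2 (S.U₀_subset_F _ (Finset.mem_coe.1 hxU))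
    · rw [Finset.disjoint_left]
      intro x hx hxs
      exact (Finset.mem_sdiff.1 hx).2 (Finset.mem_union_right _ hxs)
  probes := by
    intro ω _ n hc
    obtain ⟨e, he⟩ := Option.ne_none_iff_exists'.1 hc
    have hV : S.Valid₂ G (S.hst₂ G ω n) e := valid_of_choice₂ hΓ hA hsep hQ0 he
    have he' : (S.astOf₂ G (S.hst₂ G ω n)).st.choice = some e := by rw [← S.stN_eq₂]; exact he
    show S.nextProbe₂ G (S.hst₂ G ω n) ≠ none
    rw [S.nextProbe₂_of_valid he' hV]
    exact Option.some_ne_none _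
  fail := by
    intro h P e hP hc
    obtain ⟨e', hc', hV, rfl⟩ := S.nextProbe₂_eq_some hP
    have hc'' : (S.astOf₂ G h).st.choice = some e := by rw [← S.scheme₂_mst]; exact hc
    have hcc : some e' = some e := hc'.symm.trans hc''
    cases Option.some_injective _ hcc
    exact hfail h _ hc'' hV

/-- **The anchored cells scheme forces `θ_{root}(p) > 0` — failure bound at CHOSEN edges, no envelope bound** (proof = the lead's
`theta_pos_of_cells₂` with `lawful₂_chosen`). [cite: KozmaNitzan2024, §4 Theorem 6 (pp. 25–31)] -/
theorem theta_pos_of_cells₂_chosen (hΓ : RunGeom G S.Γ) (hA : AnchGeom S.Γ) (hsep : SepGeom₂ G S.Γ) (hX : ExitGeom G S.Γ)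
    (hδc : S.δc ≤ 1) {ε : ℝ} (hε : ε ≤ (1 / 2) ^ 32) (hp : 0 < (S.p : ℝ))
    (hQ0 : ∀ du : MDir, 1 - S.δc < (prodBernoulli (pinW (KNLevels.lattW G S.p) ↑(S.U₀ G) ↑(S.U₀ G))).real
      (⋃ t ∈ (↑(S.Γ.M S.Γ.a₀ ((0 : Site 2) + stepVec du)) : Set V),
        openConnIn (↑(S.Γ.Q S.Γ.a₀ 0 ∪ S.Γ.Ewv S.Γ.a₀ 0 du) : Set V) S.Γ.root t))
    (hfail : ∀ h e, (S.astOf₂ G h).st.choice = some e → S.Valid₂ G h e →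
      (bondPercolation G S.p).real
        {ω | ¬S.succ₂ G h e (S.aOf₁ G h e) (S.aOf₂ G h e) ((S.probe₂ G h e (S.aOf₁ G h e) (S.aOf₂ G h e)).read ω)} ≤ ε) :
    0 < theta G S.Γ.root S.p :=
  SameP.theta_pos_of_lawful (lawful₂_chosen hΓ hA hsep hQ0 hfail) hε
    (fun x hx => (mem_edgesIn_iff.1 (Finset.mem_coe.1 hx)).1) hp
    (by
      rintro ω' ⟨hA', hinf⟩
      exact Or.inl (mem_percolatesAt_of_infinite₂ hΓ hA hX (ω := ω') hδc hA' hinf))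

/-- **THE NODE OVER ANCHORED CELLS, KIT FORM, obligations at CHOSEN edges**: as `theta_pos_of_kit₂` with `hface` / `hreach` asked only
after valid histories AT THE EDGE THE SCHEME CHOOSES. [cite: KozmaNitzan2024, §4 Theorem 6 (pp. 25–31)] -/
theorem theta_pos_of_kit₂_chosen (hΓ : RunGeom G S.Γ) (hA : AnchGeom S.Γ) (hsep : SepGeom₂ G S.Γ) (hX : ExitGeom G S.Γ)
    (hSt : StepsGeom S.Γ FD) (hδc : S.δc ≤ 1) {ε ε' δ₂ : ℝ} (hε : ε ≤ (1 / 2) ^ 32) (hε' : 0 ≤ ε') (hδ₂ : δ₂ ≤ 1)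
    (hKε : 4 * ((1 - δ₂) ^ S.Γ.K + ε') ≤ ε) (hp : 0 < (S.p : ℝ))
    (hQ0 : ∀ du : MDir, 1 - S.δc < (prodBernoulli (pinW (KNLevels.lattW G S.p) ↑(S.U₀ G) ↑(S.U₀ G))).real
      (⋃ t ∈ (↑(S.Γ.M S.Γ.a₀ ((0 : Site 2) + stepVec du)) : Set V),
        openConnIn (↑(S.Γ.Q S.Γ.a₀ 0 ∪ S.Γ.Ewv S.Γ.a₀ 0 du) : Set V) S.Γ.root t))
    (hP1 : ∀ h e, S.Valid₂ G h e → ∀ du ∈ S.onward G h (tgt e), ∀ ω,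
      ω ∈ KNLevels.lattOnly G (S.Vx G h ∪ S.Γ.Ewv (S.aOf₁ G h e) e.1 e.2 ∪ FD.Hfull (S.aOf₂ G h e) (tgt e) du) →
      ω ∈ S.Reach G FD h e (S.aOf₁ G h e) (S.aOf₂ G h e) du → ω ∈ S.Aface G FD h e (S.aOf₁ G h e) (S.aOf₂ G h e) du (S.Γ.K - 1))
    (hP2 : ∀ h e, S.Valid₂ G h e → ∀ du ∈ S.onward G h (tgt e), ∀ ω j, 1 ≤ j → j < S.Γ.K →
      ω ∈ KNLevels.lattOnly G (S.Vx G h ∪ S.Γ.Ewv (S.aOf₁ G h e) e.1 e.2 ∪ S.Γ.Stub (S.aOf₂ G h e) (tgt e) du (j + 1)) →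
      ω ∈ S.Aface G FD h e (S.aOf₁ G h e) (S.aOf₂ G h e) du j → ω ∈ S.Aface G FD h e (S.aOf₁ G h e) (S.aOf₂ G h e) du (j - 1))
    (hface : ∀ h e, (S.astOf₂ G h).st.choice = some e → S.Valid₂ G h e → ∀ du ∈ S.onward G h (tgt e), ∀ j < S.Γ.K,
      ∀ o : Finset (Sym2 V),
      1 - δ₂ < (prodBernoulli (S.Wt G h e (S.aOf₁ G h e) (S.aOf₂ G h e) du j o)).real
        (⋃ b ∈ FD.Face (S.aOf₂ G h e) (tgt e) du (j + 1), openConn S.Γ.root b) →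
        S.cond G h e (S.aOf₁ G h e) (S.aOf₂ G h e) du j o)
    (hreach : ∀ h e, (S.astOf₂ G h).st.choice = some e → S.Valid₂ G h e → ∀ du ∈ S.onward G h (tgt e),
      1 - ε' < (prodBernoulli (S.Wfull G h e (S.aOf₁ G h e) (S.aOf₂ G h e) du)).real
        (S.Reach G FD h e (S.aOf₁ G h e) (S.aOf₂ G h e) du)) :
    0 < theta G S.Γ.root S.p := by
  refine theta_pos_of_cells₂_chosen hΓ hA hsep hX hδc hε hp hQ0 fun h e hc hV => ?_
  exact (fail_bound₂ hV.anch hV hSt hε' hδ₂ (hP1 h e hV) (hP2 h e hV) (hface h e hc hV) (hreach h e hc hV)).trans hKε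

/-- **THE NODE, kit form with a level geometry, obligations at CHOSEN edges** (face-prefix inputs from `LevelGeom`).
[cite: KozmaNitzan2024, §4 Theorem 6 (pp. 25–31)] -/
theorem theta_pos_of_kit₂_chosen' (hΓ : RunGeom G S.Γ) (hA : AnchGeom S.Γ) (hsep : SepGeom₂ G S.Γ) (hX : ExitGeom G S.Γ)
    (hSt : StepsGeom S.Γ FD) (hL : LevelGeom G S.Γ FD LD) (hδc : S.δc ≤ 1) {ε ε' δ₂ : ℝ} (hε : ε ≤ (1 / 2) ^ 32) (hε' : 0 ≤ ε')
    (hδ₂ : δ₂ ≤ 1) (hKε : 4 * ((1 - δ₂) ^ S.Γ.K + ε') ≤ ε) (hp : 0 < (S.p : ℝ))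
    (hQ0 : ∀ du : MDir, 1 - S.δc < (prodBernoulli (pinW (KNLevels.lattW G S.p) ↑(S.U₀ G) ↑(S.U₀ G))).real
      (⋃ t ∈ (↑(S.Γ.M S.Γ.a₀ ((0 : Site 2) + stepVec du)) : Set V),
        openConnIn (↑(S.Γ.Q S.Γ.a₀ 0 ∪ S.Γ.Ewv S.Γ.a₀ 0 du) : Set V) S.Γ.root t))
    (hface : ∀ h e, (S.astOf₂ G h).st.choice = some e → S.Valid₂ G h e → ∀ du ∈ S.onward G h (tgt e), ∀ j < S.Γ.K,
      ∀ o : Finset (Sym2 V),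
      1 - δ₂ < (prodBernoulli (S.Wt G h e (S.aOf₁ G h e) (S.aOf₂ G h e) du j o)).real
        (⋃ b ∈ FD.Face (S.aOf₂ G h e) (tgt e) du (j + 1), openConn S.Γ.root b) →
        S.cond G h e (S.aOf₁ G h e) (S.aOf₂ G h e) du j o)
    (hreach : ∀ h e, (S.astOf₂ G h).st.choice = some e → S.Valid₂ G h e → ∀ du ∈ S.onward G h (tgt e),
      1 - ε' < (prodBernoulli (S.Wfull G h e (S.aOf₁ G h e) (S.aOf₂ G h e) du)).real
        (S.Reach G FD h e (S.aOf₁ G h e) (S.aOf₂ G h e) du)) :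
    0 < theta G S.Γ.root S.p :=
  theta_pos_of_kit₂_chosen hΓ hA hsep hX hSt hδc hε hε' hδ₂ hKε hp hQ0 (fun _ _ hV => facePrefix₂_P1 hL hV)
    (fun _ _ hV => facePrefix₂_P2 hL hSt hV) hface hreach

end Node

end KSchA

end KNCells

end Transplant

end Summit.CriticalPhenomena.PercolationContinuityZ3.Theorems

end
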